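import Literature.NumberTheory.EllipticCurves.Greenberg1999.CyclotomicTorsionFinite
import Literature.NumberTheory.EllipticCurves.IwasawaTowerTorsionFiniteProofs
import HarnessLib

/-!
# Greenberg LNM 1716 §1 (p. 62): `E(ℚ_∞)[p^∞]` is finite — the named fact
# `Greenberg1999.finite_torsion_cyclotomicZpExtension` DISCHARGED (it is the cyclotomic case of the tree's
# theorem `WeierstrassCurve.finite_fixedPoints_kerSubgroup_geomPrimaryTorsion_rat`)

`Proofs`-style bridge (theorems only; no definition, no new named fact; net debt −1). The named fact
`Literature.NumberTheory.EllipticCurves.Greenberg1999.finite_torsion_cyclotomicZpExtension` (file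
`Greenberg1999/CyclotomicTorsionFinite.lean`: for `E/ℚ` elliptic, `p` prime and a CYCLOTOMIC `ℤ_p`-extension `κ`
of `ℚ`, `E(ℚ_∞)[p^∞] = (E[p^∞])^{ker κ}` is finite — Greenberg, LNM 1716 (1999) §1, paragraph after (1.8); Mazur
Prop. 6.12 / Imai / Ribet) is the binder `hB` of every torsion-tolerant TOWER door of route ByReductionTypeAtTwo
(`TowerClass.towerGapAtTwo_of_counts_of_torsion_print`, `…_of_classCounts_of_torsion_zero`, KitE, the INELIG class
files of items 19573 / 19271 / 19577). The tree meanwhile PROVES the statement for EVERY `ℤ_p`-extension of `ℚ`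
(`WeierstrassCurve.finite_fixedPoints_kerSubgroup_geomPrimaryTorsion_rat`, file `IwasawaTowerTorsionFiniteProofs`:
global road via the stable image of `B`, the absence of a `Γ_ℚ`-stable `p`-divisible line, a complex conjugation in
`ker κ` and the Weil pairing). This file records the one-line consequence `finite_torsion_cyclotomicZpExtension_holds`,
so that the binder `hB` is a THEOREM (pass the term `finite_torsion_cyclotomicZpExtension_holds`). Cell `bsd-2adic`
(run/shared/lean/pub/bsd-2adic/), seat `bsd-2adic-tower-1` GEN 6; HONEST FRAMING: nothing asserted, closes no class by
itself; BSD is not proved by any of this.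

References: [GreenbergLNM1716] R. Greenberg, LNM 1716 (1999), §1 p. 62 (paragraph after (1.8)), §3 p. 86, §4 p. 103.
-/

set_option autoImplicit false

namespace Literature.NumberTheory.EllipticCurves.Greenberg1999

/-- **Greenberg, LNM 1716 §1 (p. 62): `E(ℚ_∞)[p^∞]` is finite — DISCHARGED.** For every elliptic curve `E/ℚ`,
every prime `p` and the cyclotomic (indeed any) `ℤ_p`-extension `κ` of `ℚ`, `(E[p^∞])^{ker κ} = E(ℚ_∞)[p^∞]` is
finite: the tree's theorem `WeierstrassCurve.finite_fixedPoints_kerSubgroup_geomPrimaryTorsion_rat` (the cyclotomic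
hypothesis is not used). [cite: GreenbergLNM1716, §1 p. 62 (paragraph after (1.8))] -/
theorem finite_torsion_cyclotomicZpExtension_holds : finite_torsion_cyclotomicZpExtension :=
  fun W _ _ _ κ _ ↦ W.finite_fixedPoints_kerSubgroup_geomPrimaryTorsion_rat κ

end Literature.NumberTheory.EllipticCurves.Greenberg1999
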